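import Summits.NavierStokesRegularity.NavierStokesRegularity.Theses.AxisymmetricExtremality
import Literature.Analysis.FluidPDE.AxisymmetricEuler

/-!
# Strategist s12-g5 sketch — crux `AxisymmetricKatoGlobal` (stmt-NavierStokesRegularity-15453)

Typed artefacts of the INDEPENDENT strategy census (family `s`, gen 5):

* `NoAxisymMinimalBlowupDatum` (W₀) — the strictly-weaker THRESHOLD INSTANCE of the crux that the
  route's deciding theorem `closes` actually consumes (it applies `AxisymmetricKatoGlobal` only to an
  axisymmetric Rusin–Šverák minimal blow-up datum);
* `noAxisymMinimal_of_akg` — W₀ is implied by the crux (pure logic);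
* `closes_of_noAxisymMinimal` — the route still decides the summit with W₀ in place of the crux
  (same by-contradiction glue as `closes`, rev 2/3).

No new mechanism is claimed: the census records why W₀, though weaker, has no tool of its own
(Ḣ^{1/2}-minimality is not propagated by the flow). 0 sorry.
-/

namespace Summit.NavierStokesRegularity.NavierStokesRegularity.Cruxes.AxisymmetricKatoGlobal.StrategistS12g5

open Summit.NavierStokesRegularity.NavierStokesRegularity.Theses.AxisymmetricExtremality

/-- W₀ — threshold instance of the crux: for every `ν > 0` there is NO axisymmetric
Rusin–Šverák `Ḣ^{1/2}`-minimal blow-up datum. -/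
def NoAxisymMinimalBlowupDatum : Prop :=
  ∀ ν : ℝ, 0 < ν → ∀ (u₀ : EuclideanSpace ℝ (Fin 3) → EuclideanSpace ℝ (Fin 3))
    (g : Literature.Analysis.FunctionSpaces.HomSobolev (EuclideanSpace ℝ (Fin 3))
      (EuclideanSpace ℂ (Fin 3)) (1 / 2 : ℝ)),
    Literature.Analysis.FluidPDE.IsMinimalBlowupDatum ν u₀ g →
    Literature.Analysis.FluidPDE.IsAxisymmetric u₀ → False

/-- The crux implies its threshold instance (pure logic: a minimal blow-up datum has no global
Kato solution by definition). -/
theorem noAxisymMinimal_of_akg (h : AxisymmetricKatoGlobal) : NoAxisymMinimalBlowupDatum := by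
  intro ν hν u₀ g hmin hax
  obtain ⟨hL3, hrep, hdiv, -, hnot⟩ := hmin
  exact hnot (h ν hν u₀ g hL3 hrep hdiv hax)

/-- Re-glued deciding theorem: the route decides the summit from `MinimalDatumPFold`,
`PFoldToAxisymmetric` (proved) and the threshold instance W₀ alone. -/
theorem closes_of_noAxisymMinimal (h₂ : MinimalDatumPFold) (h₄ : PFoldToAxisymmetric)
    (h₃ : NoAxisymMinimalBlowupDatum) : NavierStokesRegularity := by
  show Literature.NS.NavierStokesExistenceSmoothR3
  intro ν hν u₀ hsm hdiv hdec
  by_contra hno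
  obtain ⟨u₁, g, hmin, hax⟩ := h₄ ν hν (h₂ ν hν ⟨u₀, hsm, hdiv, hdec, hno⟩)
  exact h₃ ν hν u₁ g hmin hax

end Summit.NavierStokesRegularity.NavierStokesRegularity.Cruxes.AxisymmetricKatoGlobal.StrategistS12g5
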